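import Summits.NavierStokesRegularity.NavierStokesRegularity.Theses.SwallowedContinuum
import Literature.Analysis.FluidPDE.SuitableWeak
import Literature.Analysis.FluidPDE.KNSSTypeIIHolds
import HarnessLib.Audit

/-!
# Birth skeleton (BC3) for crux `SwallowedContinuum.NoCollisionFreeBlowup` (stmt-NavierStokesRegularity-17614)

planner-skel-stmt-NavierStokesRegularity-17614-0 · skeleton-register (BC3, one-shot, re-audit bin HONEST) ·
2026-08-17. Route `route-NavierStokesRegularity-SwallowedContinuum` (rev 1, open), crux #4 (rank 4, OPEN,
difficulty open-problem; grounded NEW / open-problem by g77-7, g77-8; crux-attack r1 SURVIVES).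

**THE CRUX (point sector, "what blows up must bring fluid particles together").** For `ν > 0`, `T > 0`,
a classical solution `(u, p)` of unforced NS on `ℝ³ × [0, T)`, Leray–Hopf on `[0, T]` from a rapidly
decaying datum, a flow map `X` of `u` on `[0, T)` (`X 0 = id`, `∂ₛ X(s, a) = u(s, X(s, a))` within
`[0, T)`) with uniform limit `Xs` as `t ↑ T`: if the endpoint map `Xs` is INJECTIVE (no two fluid
particles collide at time `T`) then `u` extends as a classical solution past `T`.

## The line — RATE DICHOTOMY OF A COLLISION-FREE SINGULARITY (the route's own TWO-LAYER PLAN)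

The route header files the first split of every sector as "K ⇐ K_TypeI → K_notTypeI → K, split by the
in-tree rate predicate `IsTypeIBlowup u T`" and reads the Type-I child of this crux as "a Type-I profile
whose bounded orbits are all sources is trivial". This skeleton types that plan with the two sectors
stated POSITIVELY, through the sup-norm of `u`, and closes the seam with the tree's PROVED continuation
theorem for bounded Leray–Hopf classical solutions
(`Literature.Analysis.FluidPDE.hasSmoothExtensionPast_of_bounded_holds`, Robinson–Rodrigo–Sadowski 2016
Thm. 8.17 = contrapositive of Leray's rate `‖u(t)‖_∞ ≥ c √ν (T − t)^{-1/2}`, also proved in tree as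
`leray_blowup_rate_top_holds`):

* S1 `stub_collisionFree_isTypeI` — **A COLLISION-FREE SINGULARITY IS AT MOST TYPE I** (the
  not-Type-I sector, contrapositively): under the crux hypotheses, `Function.Injective Xs` forces the
  self-similar rate `‖u(t, x)‖ ≤ C / √(T − t)` eventually as `t ↑ T` (`IsTypeIBlowup u T`). OPEN.
* S2 `stub_typeI_collisionFree_bounded` — **A TYPE-I COLLISION-FREE SINGULARITY IS NO SINGULARITY**
  (the Type-I sector): under the crux hypotheses plus `IsTypeIBlowup u T`, `Function.Injective Xs`
  forces `u` to stay bounded on `[0, T) × ℝ³`. OPEN — the HARDEST stub (the bet of the crux in the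
  regime where tangent flows exist).

Composition `NoCollisionFreeBlowup_of : NoCollisionFreeBlowup` (proved below from the two stubs, used
BY NAME, and the continuation theorem; the only theorem of this file concluding the crux; no `Prop`
hypotheses): S1 gives the Type-I rate, S2 turns rate + injectivity into a velocity bound on `[0, T)`,
and `hasSmoothExtensionPast_of_bounded_holds` continues the bounded Leray–Hopf classical solution past
`T`. Its closed twin with the stub STATEMENTS as hypotheses (`NoCollisionFreeBlowup_of_hyps`, axioms
`propext`/`Classical.choice`/`Quot.sound`) is the `example` at the end of this file and the registrar's
folder evidence `bc/NoCollisionFreeBlowup_birth_closed.lean`.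

Logically `crux ⟺ S1 ∧ S2` on paper (crux ⇒ S1, S2: a classical extension past `T` of the Leray–Hopf
solution keeps `u` bounded near `T` by CKN regularity at spatial infinity + weak–strong uniqueness,
hence Type I and bounded; S1 ∧ S2 ⇒ crux: this file), and neither stub is the crux or the summit in
costume: S1 allows a Type-I collision-free blow-up, S2 says nothing about Type II (BC3 probes below).

## Why each stub is plausible, and what it leans on

* S1 (OPEN; "collision-free ⇒ at most Type I"). In the Type-II regime `sup_x ‖u(t)‖ √(T − t)` is
  unbounded along `t ↑ T` while the swallowing budget `δ(t) = ∫_t^T ‖u‖_∞ → 0` stays finite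
  (bounded total speed, Tao 2013 Prop. 9.1, in tree: `tao2011_boundedTotalSpeed_unit_holds`); the bet
  is that a faster-than-self-similar concentration of speed inside an ever smaller region, with the
  energy inequality and `∇u ∈ L²L²`, cannot be realised by a volume-preserving flow WITHOUT crushing a
  material continuum (two labels with a common endpoint) — i.e. Type-II speed needs radial inflow.
  WHY IT MIGHT FAIL: a confined, ever faster WINDING (pure swirl spin-up, `u_θ ~ r^{-1/2}` profile at
  `T`) is kinematically collision-free at any rate; the stub needs dynamics. Leans on:
  `Literature.Analysis.FluidPDE.IsTypeIBlowup` (SuitableWeak.lean), `IsTypeIIBlowup`,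
  `tao2011_boundedTotalSpeed_unit_holds`, CKN vocabulary (`IsRegularPoint`, `singularSet`), the
  Type-II zoom-in of the tree (`Literature.Analysis.FluidPDE.KNSSTypeIIZoomIn`).
  [Tao2011 Prop. 9.1; doi:10.1088/0951-7715/22/9/002; KochNadirashviliSereginSverak2009 §6]
* S2 (OPEN, hardest; "Type I + collision-free ⇒ bounded"). In the Type-I regime blow-up sequences
  converge to nontrivial bounded ancient MILD solutions (KNSS 2009 Thm. 6.x machinery, in tree:
  `KNSS2009_typeI_rate_blowupSequence_holds`, `KNSS2009_typeI_rate_mildBlowupSequence_holds`;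
  Seregin–Šverák 2009) and, in a (D)SS similarity frame `y = (x − x₀)/√(T − t)`, `s = −log(T − t)`,
  particle paths follow `ẏ = U(y, s) + y/2` (`div = 3/2`): the swallowed set of `x₀` is the set of
  labels with BOUNDED forward similarity orbit, nonempty by a degree argument and — the bet —
  containing at least two labels unless the profile is trivial (a Type-I profile "whose bounded orbits
  are all sources" is zero), whereas a trivial blow-up limit means `(T, x₀)` is regular
  (ε-regularity). So injectivity of `Xs` kills every Type-I singular point, CKN regularity at spatial
  infinity and compactness give the bound near `T`, and the bound on `[0, T'] × ℝ³`, `T' < T`, is in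
  tree (`liouvilleKillsTypeI_exists_bound_Icc`, Theorems.SymmetryModuliCountLiouvilleKillsTypeI; Tao
  2013 Cor. 11.1 + `H² ⊂ C_B`). WHY IT MIGHT FAIL: a Type-I profile with a single bounded orbit that
  is a spiral SOURCE in similarity variables (all other labels escape, i.e. freeze at positive
  distance) is not excluded by anything in print; DSS (non-SS) Type-I limits make "the" profile
  time-periodic in `s` and the orbit structure Floquet-type. Leans on: `IsTypeIBlowup.exists_sqrt_mul_norm_le`,
  `exists_window_of_isTypeIBlowup` (Theorems.AdaptedFrequencyTangentFlowTransferZoomFrequency), the KNSS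
  Type-I toolkit (`KNSSTypeIRate*`, `TypeIAncientMild`), ε-regularity (`CaffarelliKohnNirenberg1982`
  facts in `SuitableWeak`/`CKN*`), `liouvilleKillsTypeI_exists_bound_Icc`.
  [KochNadirashviliSereginSverak2009 Thm 6.2; SereginSverak2009; Tao2011; Daverman1986 (orbit-set topology)]

## Disproof used / negatives / dead lines

No `Disproof.lean`, no `Negative/` lemma, no crux idea and no earlier registered line exist for this
crux (`ledger crux ls stmt-NavierStokesRegularity-17614`: no workfiles, 2026-08-17) — there is no
`_false_without_<H>` obligation to honour. The refuter's crux attack r1 (evidence W.lean / ATTACK.md on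
the item) establishes: the crux SURVIVES; it is non-vacuous (rest state, `X = id`, `Xs = id`); each of
the four Lagrangian hypotheses is load-bearing (dropping any one collapses the crux to NoBlowup) —
honoured: both stubs carry all four, and `Function.Injective Xs` is consumed by BOTH stubs (without it
S1 would read "every blow-up is Type I" and S2 "no Type-I blow-up", two summit-level statements this
line does not claim); `NoBlowup' → crux` (refuter, 2 lines) is respected: the stubs are weaker than
NoBlowup' in the same way. Negatives index (`ledger negatives --problem NavierStokesRegularity`): no
Lagrangian / endpoint-map statement; no stub restates one.

## BC3 audit (registrar, 2026-08-17; raw outputs in the registrar's NOTES.md / bc/ folder)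

`lean check --json`: rc 0, sorries = 2 = the two `stub_*` (zero elsewhere; `NoCollisionFreeBlowup_of_hyps`
standard axioms). Probes importing this file's imports but NOT this file (route file, hence the
Statement; `SuitableWeak`; `KNSSTypeIIHolds`), `maxHeartbeats 400000`,
`first | exact? | simpa | aesop`: `S → NoCollisionFreeBlowup` FAILS and `S → NavierStokesRegularity`
FAILS for S = S1 and S = S2 (4/4). See `Lines/birth.md`.
-/

noncomputable section

namespace Summit.NavierStokesRegularity.NavierStokesRegularity.Cruxes.NoCollisionFreeBlowup.Birth

set_option linter.unusedVariables false
set_option linter.dupNamespace false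

/-! ## The stubs S1–S2 (the only `sorry`s of the file) -/

/-- **S1 `stub_collisionFree_isTypeI` — A COLLISION-FREE SINGULARITY IS AT MOST TYPE I** (OPEN; the
not-Type-I sector of the crux, stated contrapositively as a rate bound). Hypotheses = the crux's,
verbatim (classical on `[0,T)`, Leray–Hopf on `[0,T]`, rapidly decaying datum, flow map `X`, uniform
endpoint map `Xs`, `Xs` injective); conclusion: the Type-I rate at `T`,
`∃ C, ∀ᶠ t ↑ T, ∀ x, ‖u t x‖ ≤ C / √(T − t)` (`Literature.Analysis.FluidPDE.IsTypeIBlowup u T`, which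
does not assert that `T` is singular: a solution bounded near `T` satisfies it). Size: open problem.
[Tao2011 Prop. 9.1; doi:10.1088/0951-7715/22/9/002; KochNadirashviliSereginSverak2009 §6] -/
theorem stub_collisionFree_isTypeI :
    ∀ (ν T : ℝ), 0 < ν → 0 < T →
      ∀ (u : ℝ → EuclideanSpace ℝ (Fin 3) → EuclideanSpace ℝ (Fin 3))
        (p : ℝ → EuclideanSpace ℝ (Fin 3) → ℝ),
        Literature.Analysis.FluidPDE.IsClassicalNSSolutionOn (Set.Ico 0 T) ν 0 u p →
        Literature.Analysis.FluidPDE.IsLerayHopfOn T ν 0 (u 0) u →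
        Literature.Analysis.FluidPDE.HasRapidSpatialDecay (u 0) →
        ∀ (X : ℝ → EuclideanSpace ℝ (Fin 3) → EuclideanSpace ℝ (Fin 3))
          (Xs : EuclideanSpace ℝ (Fin 3) → EuclideanSpace ℝ (Fin 3)),
          (∀ a, X 0 a = a) →
          (∀ a, ∀ t ∈ Set.Ico 0 T, HasDerivWithinAt (fun s => X s a) (u t (X t a)) (Set.Ico 0 T) t) →
          TendstoUniformly X Xs (nhdsWithin T (Set.Iio T)) →
          Function.Injective Xs →
          Literature.Analysis.FluidPDE.IsTypeIBlowup u T := by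
  sorry

/-- **S2 `stub_typeI_collisionFree_bounded` — A TYPE-I COLLISION-FREE SINGULARITY IS NO SINGULARITY**
(OPEN, the hardest stub; the Type-I sector of the crux). Hypotheses = the crux's, verbatim, plus the
Type-I rate `IsTypeIBlowup u T`; conclusion: `u` is bounded on `[0, T) × ℝ³`. (The bound on every
earlier slab `[0, T'] × ℝ³`, `T' < T`, is in tree — `liouvilleKillsTypeI_exists_bound_Icc`, Tao 2013
Cor. 11.1 + `H² ⊂ C_B` — so the content is the bound as `t ↑ T`: in similarity variables the swallowed
set of a Type-I singular point is the bounded-forward-orbit set of `ẏ = U + y/2`, and the bet is that it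
has two labels unless the tangent flow is trivial, i.e. the point regular.) Size: open problem.
[KochNadirashviliSereginSverak2009 Thm 6.2; SereginSverak2009; Tao2011 Cor. 11.1] -/
theorem stub_typeI_collisionFree_bounded :
    ∀ (ν T : ℝ), 0 < ν → 0 < T →
      ∀ (u : ℝ → EuclideanSpace ℝ (Fin 3) → EuclideanSpace ℝ (Fin 3))
        (p : ℝ → EuclideanSpace ℝ (Fin 3) → ℝ),
        Literature.Analysis.FluidPDE.IsClassicalNSSolutionOn (Set.Ico 0 T) ν 0 u p →
        Literature.Analysis.FluidPDE.IsLerayHopfOn T ν 0 (u 0) u →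
        Literature.Analysis.FluidPDE.HasRapidSpatialDecay (u 0) →
        ∀ (X : ℝ → EuclideanSpace ℝ (Fin 3) → EuclideanSpace ℝ (Fin 3))
          (Xs : EuclideanSpace ℝ (Fin 3) → EuclideanSpace ℝ (Fin 3)),
          (∀ a, X 0 a = a) →
          (∀ a, ∀ t ∈ Set.Ico 0 T, HasDerivWithinAt (fun s => X s a) (u t (X t a)) (Set.Ico 0 T) t) →
          TendstoUniformly X Xs (nhdsWithin T (Set.Iio T)) →
          Literature.Analysis.FluidPDE.IsTypeIBlowup u T →
          Function.Injective Xs →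
          ∃ M : ℝ, ∀ t ∈ Set.Ico 0 T, ∀ x, ‖u t x‖ ≤ M := by
  sorry

/-! ## The composition (kernel-checked; its only placeholders are the two stubs, used BY NAME) -/

/-- **`NoCollisionFreeBlowup` from the two registered stubs** — the skeleton theorem (the ONLY theorem
of this file concluding the crux, literally the route decl, no `Prop` hypotheses): given the crux
hypotheses and `Function.Injective Xs`, S1 yields the Type-I rate at `T`, S2 the velocity bound on
`[0, T) × ℝ³`, and the PROVED continuation theorem for bounded Leray–Hopf classical solutions
(`hasSmoothExtensionPast_of_bounded_holds`, RRS 2016 Thm. 8.17) the classical extension past `T`. -/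
theorem NoCollisionFreeBlowup_of :
    Summit.NavierStokesRegularity.NavierStokesRegularity.Theses.SwallowedContinuum.NoCollisionFreeBlowup := by
  intro ν T hν hT u p hcl hLH hdec X Xs h0 hode hlim hinj
  -- S1 (not-Type-I sector): a collision-free singularity blows up at most at the Type-I rate.
  have hI : Literature.Analysis.FluidPDE.IsTypeIBlowup u T :=
    stub_collisionFree_isTypeI ν T hν hT u p hcl hLH hdec X Xs h0 hode hlim hinj
  -- S2 (Type-I sector): Type-I rate + collision-free endpoint map ⇒ `u` bounded on `[0, T) × ℝ³`.
  have hbdd : ∃ M : ℝ, ∀ t ∈ Set.Ico 0 T, ∀ x, ‖u t x‖ ≤ M :=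
    stub_typeI_collisionFree_bounded ν T hν hT u p hcl hLH hdec X Xs h0 hode hlim hI hinj
  -- Seam (PROVED in tree): a bounded Leray–Hopf classical solution extends past `T`.
  exact Literature.Analysis.FluidPDE.hasSmoothExtensionPast_of_bounded_holds hν hT hcl hLH hbdd

/-- CLOSED TWIN (`NoCollisionFreeBlowup_of_hyps`): the two stub STATEMENTS imply the crux, sorry-free.
Deliberately an `example` — a second named theorem concluding the crux would compete with
`NoCollisionFreeBlowup_of` in the skeleton audit; the named, `#print axioms`-checked copy
(`propext`, `Classical.choice`, `Quot.sound`) is the registrar's `bc/NoCollisionFreeBlowup_birth_closed.lean`. -/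
example
    (h₁ : ∀ (ν T : ℝ), 0 < ν → 0 < T →
      ∀ (u : ℝ → EuclideanSpace ℝ (Fin 3) → EuclideanSpace ℝ (Fin 3))
        (p : ℝ → EuclideanSpace ℝ (Fin 3) → ℝ),
        Literature.Analysis.FluidPDE.IsClassicalNSSolutionOn (Set.Ico 0 T) ν 0 u p →
        Literature.Analysis.FluidPDE.IsLerayHopfOn T ν 0 (u 0) u →
        Literature.Analysis.FluidPDE.HasRapidSpatialDecay (u 0) →
        ∀ (X : ℝ → EuclideanSpace ℝ (Fin 3) → EuclideanSpace ℝ (Fin 3))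
          (Xs : EuclideanSpace ℝ (Fin 3) → EuclideanSpace ℝ (Fin 3)),
          (∀ a, X 0 a = a) →
          (∀ a, ∀ t ∈ Set.Ico 0 T, HasDerivWithinAt (fun s => X s a) (u t (X t a)) (Set.Ico 0 T) t) →
          TendstoUniformly X Xs (nhdsWithin T (Set.Iio T)) →
          Function.Injective Xs →
          Literature.Analysis.FluidPDE.IsTypeIBlowup u T)
    (h₂ : ∀ (ν T : ℝ), 0 < ν → 0 < T →
      ∀ (u : ℝ → EuclideanSpace ℝ (Fin 3) → EuclideanSpace ℝ (Fin 3))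
        (p : ℝ → EuclideanSpace ℝ (Fin 3) → ℝ),
        Literature.Analysis.FluidPDE.IsClassicalNSSolutionOn (Set.Ico 0 T) ν 0 u p →
        Literature.Analysis.FluidPDE.IsLerayHopfOn T ν 0 (u 0) u →
        Literature.Analysis.FluidPDE.HasRapidSpatialDecay (u 0) →
        ∀ (X : ℝ → EuclideanSpace ℝ (Fin 3) → EuclideanSpace ℝ (Fin 3))
          (Xs : EuclideanSpace ℝ (Fin 3) → EuclideanSpace ℝ (Fin 3)),
          (∀ a, X 0 a = a) →
          (∀ a, ∀ t ∈ Set.Ico 0 T, HasDerivWithinAt (fun s => X s a) (u t (X t a)) (Set.Ico 0 T) t) →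
          TendstoUniformly X Xs (nhdsWithin T (Set.Iio T)) →
          Literature.Analysis.FluidPDE.IsTypeIBlowup u T →
          Function.Injective Xs →
          ∃ M : ℝ, ∀ t ∈ Set.Ico 0 T, ∀ x, ‖u t x‖ ≤ M) :
    Summit.NavierStokesRegularity.NavierStokesRegularity.Theses.SwallowedContinuum.NoCollisionFreeBlowup := by
  intro ν T hν hT u p hcl hLH hdec X Xs h0 hode hlim hinj
  exact Literature.Analysis.FluidPDE.hasSmoothExtensionPast_of_bounded_holds hν hT hcl hLH
    (h₂ ν T hν hT u p hcl hLH hdec X Xs h0 hode hlim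
      (h₁ ν T hν hT u p hcl hLH hdec X Xs h0 hode hlim hinj) hinj)

end Summit.NavierStokesRegularity.NavierStokesRegularity.Cruxes.NoCollisionFreeBlowup.Birth

end
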